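import Summits.BirchSwinnertonDyer.BirchSwinnertonDyer.Theorems.TwoAdicConverseGoodTwists
import HarnessLib

/-!
# Route `TwoAdicConverse` (rung S3): crux `GoodOrdinaryRankZeroTwoConverse` + residual
# `RankOneTwoConverse` ⟹ rank BSD for `100 %` of the good twists and Goldfeld `50 / 50`, for every
# non-CM curve good ordinary at `2` — the rung's head line in Smith's currency

Cell `bsd-2adic` (run/shared/lean/pub/bsd-2adic/), seat `bsd-2adic-conv-1`; companion of
`Theorems/TwoAdicConverseGoodTwists.lean` (the rank-`0` half from the crux alone). THEOREMS ONLY — no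
named fact, no axiom, no definition; every deep input is a named fact of the tree or an OPEN route
decl / rung leaf, carried as an explicit hypothesis.

Objects as in the companion file: `W / ℚ` globally minimal, NON-CM, good ORDINARY at `2`; the good
family `𝓕 = {d squarefree : d ≡ 1 (mod 4)}` of quadratic twists (the class is closed under `𝓕`,
`TwoAdicGoodTwists.not_hasCM_and_goodOrd_of_smul_eq_quadraticTwist`). Hypotheses: `hConv` = the crux
`Theses.TwoAdicConverse.GoodOrdinaryRankZeroTwoConverse` (item stmt-BirchSwinnertonDyer-19218, OPEN),
`hR1` = the route's declared RESIDUAL `Theses.TwoAdicConverse.RankOneTwoConverse` (item 19220, OPEN —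
no prover is seated on it; it enters ONLY as a displayed hypothesis), `hGZK` = Gross–Zagier–Kolyvagin,
`hmod : exists_isNewformOf` = Modularity, `hS : smith_selmerCorank_density W` = Smith 2025 Thm. 1.1
for `W`.

* §1 ONE TWIST: `rankOne_bsd_quadraticTwist_of_selmerCorankTwoInfty_eq_one` (`hR1`: corank `1` ⟹
  `ord L = rank = 1`, `Ш` finite) and `bsdRank_quadraticTwist_of_selmerCorankTwoInfty_le_one`
  (`hConv` + `hR1`: corank `r ≤ 1` ⟹ `ord L = rank = r`, `Ш` finite), by transport to a minimal
  model of `W^{(d)}`, which is again non-CM and good ordinary at `2`.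
* §2 DENSITY: `tendsto_bsdRank` — rank BSD (`ord_{s=1} L(W^{(d)}, s) = rank W^{(d)}(ℚ)`, `Ш` finite)
  for `100 %` of `d ∈ 𝓕` (relative density one; absolute form
  `twistDensity_bsdRank_of_emod_four_eq_one`); `tendsto_familyProportion_rankZero_of_residual` /
  `tendsto_familyProportion_rankOne` — Goldfeld's `50 / 50` in `𝓕` with BSD (root-number
  equidistribution in `𝓕` from Modularity, `GoldfeldGoodTwists.tendsto_familyProportion_rootNumber_eq_one`,
  and `(−1)^{r_an} = w` on the good set).
* §3 FROM THE RUNG LEAF: `bsdRank_and_goldfeld_goodTwists_of_nonCMTwoConverse` — the leaf S3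
  `Rank1Residual.NonCMTwoConverse` (rank-`0`/`1` `2`-converse for non-CM curves good ordinary or
  multiplicative at `2`) contains `hConv` and `hR1`; with GZK, Modularity and Smith's Thm. 1.1 it
  gives rank BSD for `100 %` of `𝓕` and Goldfeld `50 / 50` for EVERY non-CM `W` good ordinary at `2`
  — LADDER-BSD §1 row S3's head line («S3 ⇒ BSD-rank + Goldfeld for 100 % of good-at-2 twists of
  every such E») as a kernel theorem modulo named facts, on the good-ordinary branch.

HONEST FRAMING. Nothing here proves the crux, the residual, the leaf, or BSD; the theorems record the
VALUE of the route's items. The non-CM `2`-converses are open (every printed `p`-converse has `p` odd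
or `E` CM: Skinner 2020, Kim 2022, W. Zhang 2014, BSTW 2024 «p ∤ 2N»; Burungale–Tian / BCST at
`p = 2` are CM); Smith's Thm. 1.1 (arXiv:2503.17619), GZK and Modularity are named facts taken as
hypotheses. Says nothing about `d ≢ 1 (mod 4)` (additive `2`: no door, I2) nor about the
multiplicative-at-`2` branch of the leaf (crux 19219, seat conv-2). PARTITION (D-0054): none — RANK
axis (S3); companion formula cell X5@2 good-ord (B1·O1; 611 book230 classes), owner bsd-2adic. TWIN
(D-0056): `RankOneTwoConverse` ↔ K4 residual `RankOneAtTwo` (item 19099) — p-part OPEN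
(`RankOneIndexIdentityAtTwo`).

References: A. Smith, arXiv:2503.17619 (2025), Thm. 1.1, Cor. 1.2–1.3 [arXiv250317619]; D. Goldfeld,
LNM 751 (1979); A. Burungale, Y. Tian, Ann. of Math. 203 (2026), Thm. 1.2 (the CM template)
[BurungaleTian2026]; C. Skinner, Ann. of Math. 191 (2020) (p ≥ 5) [Skinner2020Converse];
R. Greenberg, LNM 1716 (1999), §1 [GreenbergLNM1716]; M. R. Murty, V. K. Murty (1997), Ch. 6 §1
[MurtyMurty1997]; J. H. Silverman, *AEC* (2009), VII.1.3, X.5.4, C.16 [SilvermanAEC2009].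
-/

set_option linter.dupNamespace false
set_option autoImplicit false

noncomputable section

open scoped Classical

open Filter Topology WeierstrassCurve Literature.NumberTheory.EllipticCurves
  Literature.NumberTheory.EllipticCurves.ModularForms
  Literature.NumberTheory.EllipticCurves.Rank1Residual
  Summit.BirchSwinnertonDyer.BirchSwinnertonDyer.Theses.TwoAdicConverse
  Summit.BirchSwinnertonDyer.BirchSwinnertonDyer.Theorems.GoldfeldGoodTwists

namespace Summit.BirchSwinnertonDyer.BirchSwinnertonDyer.Theorems.TwoAdicGoodTwists

/-! ## §1 One good twist, with the residual -/

/-- **Rank-`1` BSD for one good twist, from the residual.** Assume the rank-`1` `2`-converse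
`RankOneTwoConverse` (`hR1`, item stmt-BirchSwinnertonDyer-19220, the route's declared residual,
OPEN) and `hGZK`. For `W` as above and `d ≡ 1 (mod 4)` with `corank_{ℤ_2} Sel_{2^∞}(W^{(d)}/ℚ) = 1`:
`ord_{s=1} L(W^{(d)}, s) = rank W^{(d)}(ℚ) = 1` and `Ш(W^{(d)}/ℚ)` is finite.
[cite: arXiv250317619, §1 (the p-converse input of Cor. 1.2)] [cite: GreenbergLNM1716, §1 pp. 54–57] -/
theorem rankOne_bsd_quadraticTwist_of_selmerCorankTwoInfty_eq_one
    (hR1 : RankOneTwoConverse) (hGZK : rank_eq_analyticRank_of_analyticRank_le_one)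
    (W : WeierstrassCurve ℚ) [W.IsElliptic] [W.IsGloballyMinimal] (hCM : ¬ W.HasCM)
    (hgo : GoodOrd W 2) {d : ℤ} (hd4 : d % 4 = 1)
    (h1 : selmerCorankTwoInfty (W.quadraticTwist d) = 1) :
    (W.quadraticTwist d).analyticRank = 1 ∧ (W.quadraticTwist d).mordellWeilRank = 1 ∧
      Finite (W.quadraticTwist d).sha := by
  have hd0 : ((d : ℤ) : ℚ) ≠ 0 := by exact_mod_cast (show d ≠ 0 by omega)
  haveI := W.isElliptic_quadraticTwist hd0
  obtain ⟨W', hW'ell, hW'min, C, hC⟩ := exists_isGloballyMinimal_smul_eq_quadraticTwist W hd0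
  obtain ⟨hCM', hgo'⟩ := not_hasCM_and_goodOrd_of_smul_eq_quadraticTwist W W' hCM hgo hd4 hC
  have hcor' : W'.selmerCorank 2 = 1 := by
    rw [selmerCorank_eq_of_variableChange 2 hC, ← selmerCorankTwoInfty_eq]; exact h1
  have har : (W.quadraticTwist (d : ℚ)).analyticRank = 1 := by
    rw [← hC, analyticRank_smul]; exact hR1 W' hCM' (Or.inl hgo') hcor'
  obtain ⟨hrank, hsha⟩ := hGZK (W.quadraticTwist (d : ℚ)) (by omega)
  exact ⟨har, by rw [hrank, har], hsha⟩

/-- **Rank BSD for one good twist of Selmer corank `≤ 1`, from crux + residual.** Under `hConv`,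
`hR1`, `hGZK`: for `W` as above, `d ≡ 1 (mod 4)` and `r := corank_{ℤ_2} Sel_{2^∞}(W^{(d)}/ℚ) ≤ 1`,
`ord_{s=1} L(W^{(d)}, s) = rank W^{(d)}(ℚ) = r` and `Ш(W^{(d)}/ℚ)` is finite.
[cite: arXiv250317619, §1 (Cor. 1.2 under BSD)] -/
theorem bsdRank_quadraticTwist_of_selmerCorankTwoInfty_le_one
    (hConv : GoodOrdinaryRankZeroTwoConverse) (hR1 : RankOneTwoConverse)
    (hGZK : rank_eq_analyticRank_of_analyticRank_le_one)
    (W : WeierstrassCurve ℚ) [W.IsElliptic] [W.IsGloballyMinimal] (hCM : ¬ W.HasCM)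
    (hgo : GoodOrd W 2) {d : ℤ} (hd4 : d % 4 = 1)
    (hle : selmerCorankTwoInfty (W.quadraticTwist d) ≤ 1) :
    (W.quadraticTwist d).analyticRank = selmerCorankTwoInfty (W.quadraticTwist d) ∧
      (W.quadraticTwist d).mordellWeilRank = selmerCorankTwoInfty (W.quadraticTwist d) ∧
        Finite (W.quadraticTwist d).sha := by
  rcases Nat.le_one_iff_eq_zero_or_eq_one.mp hle with h0 | h1
  · obtain ⟨har, hrank, hsha⟩ :=
      rankZero_bsd_quadraticTwist_of_selmerCorankTwoInfty_eq_zero hConv hGZK W hCM hgo hd4 h0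
    exact ⟨by rw [har, h0], by rw [hrank, h0], hsha⟩
  · obtain ⟨har, hrank, hsha⟩ :=
      rankOne_bsd_quadraticTwist_of_selmerCorankTwoInfty_eq_one hR1 hGZK W hCM hgo hd4 h1
    exact ⟨by rw [har, h1], by rw [hrank, h1], hsha⟩

/-! ## §2 With the residual: rank BSD for `100 %` of `𝓕` and Goldfeld `50 / 50` -/

section WithResidual

variable (W : WeierstrassCurve ℚ) [W.IsElliptic] [W.IsGloballyMinimal]

/-- **Rank BSD holds for `100 %` of the good quadratic twists** (absolute form), from crux +
residual. Under `hConv`, `hR1`, `hGZK` and Smith's Thm. 1.1 for `W`: the squarefree `d` with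
"`d ≡ 1 (mod 4)` ⟹ `ord_{s=1} L(W^{(d)}, s) = rank W^{(d)}(ℚ) ∧ Ш(W^{(d)}/ℚ)` finite" have
density `1`. [cite: arXiv250317619, Thm. 1.1 and Cor. 1.2] -/
theorem twistDensity_bsdRank_of_emod_four_eq_one
    (hConv : GoodOrdinaryRankZeroTwoConverse) (hR1 : RankOneTwoConverse)
    (hGZK : rank_eq_analyticRank_of_analyticRank_le_one)
    (hCM : ¬ W.HasCM) (hgo : GoodOrd W 2) (hS : smith_selmerCorank_density W) :
    twistDensity (fun d ↦ d % 4 = 1 →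
      (W.quadraticTwist d).analyticRank = (W.quadraticTwist d).mordellWeilRank ∧
        Finite (W.quadraticTwist d).sha) 1 := by
  refine twistDensity_one_mono (fun d _ hRd hd4 ↦ ?_) (twistDensity_selmerCorankTwoInfty_le_one_of W hS)
  obtain ⟨har, hrank, hsha⟩ :=
    bsdRank_quadraticTwist_of_selmerCorankTwoInfty_le_one hConv hR1 hGZK W hCM hgo hd4 hRd.2
  exact ⟨har.trans hrank.symm, hsha⟩

/-- **Rank BSD for `100 %` of the good twists of a non-CM curve good ordinary at `2`** (relative
form), from crux + residual: for `d ∈ 𝓕` of relative density `1`,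
`ord_{s=1} L(W^{(d)}, s) = rank W^{(d)}(ℚ) = corank_{ℤ_2} Sel_{2^∞}(W^{(d)}/ℚ) ≤ 1` and
`Ш(W^{(d)}/ℚ)` is finite. [cite: arXiv250317619, Thm. 1.1 and Cor. 1.2] -/
theorem tendsto_bsdRank_eq_selmerCorankTwoInfty
    (hConv : GoodOrdinaryRankZeroTwoConverse) (hR1 : RankOneTwoConverse)
    (hGZK : rank_eq_analyticRank_of_analyticRank_le_one)
    (hCM : ¬ W.HasCM) (hgo : GoodOrd W 2) (hS : smith_selmerCorank_density W) :
    Tendsto (fun X : ℕ ↦ (Nat.card {d : ℤ | Squarefree d ∧ |d| ≤ (X : ℤ) ∧ (d % 4 = 1 ∧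
        (selmerCorankTwoInfty (W.quadraticTwist d) ≤ 1 ∧
          (W.quadraticTwist d).analyticRank = selmerCorankTwoInfty (W.quadraticTwist d) ∧
          (W.quadraticTwist d).mordellWeilRank = selmerCorankTwoInfty (W.quadraticTwist d) ∧
          Finite (W.quadraticTwist d).sha))} : ℝ) /
      Nat.card {d : ℤ | Squarefree d ∧ |d| ≤ (X : ℤ) ∧ d % 4 = 1}) atTop (𝓝 1) := by
  have hR := twistDensity_selmerCorankTwoInfty_le_one_of W hS
  have h0 : twistDensity (fun d ↦ ¬ (d ≠ 0 ∧ selmerCorankTwoInfty (W.quadraticTwist d) ≤ 1)) 0 := by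
    simpa using hR.compl
  refine tendsto_familyProportion_one_of_twistDensity_zero (h0.mono_zero fun d _ h hRd ↦ h.2 ?_)
  exact ⟨hRd.2, bsdRank_quadraticTwist_of_selmerCorankTwoInfty_le_one hConv hR1 hGZK W hCM hgo h.1
    hRd.2⟩

/-- The headline shape: for `100 %` of `d ∈ 𝓕`, `ord_{s=1} L(W^{(d)}, s) = rank W^{(d)}(ℚ)` and
`Ш(W^{(d)}/ℚ)` is finite. [cite: arXiv250317619, Thm. 1.1 and Cor. 1.2] -/
theorem tendsto_bsdRank
    (hConv : GoodOrdinaryRankZeroTwoConverse) (hR1 : RankOneTwoConverse)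
    (hGZK : rank_eq_analyticRank_of_analyticRank_le_one)
    (hCM : ¬ W.HasCM) (hgo : GoodOrd W 2) (hS : smith_selmerCorank_density W) :
    Tendsto (fun X : ℕ ↦ (Nat.card {d : ℤ | Squarefree d ∧ |d| ≤ (X : ℤ) ∧ (d % 4 = 1 ∧
        ((W.quadraticTwist d).analyticRank = (W.quadraticTwist d).mordellWeilRank ∧
          Finite (W.quadraticTwist d).sha))} : ℝ) /
      Nat.card {d : ℤ | Squarefree d ∧ |d| ≤ (X : ℤ) ∧ d % 4 = 1}) atTop (𝓝 1) := by
  have hR := twistDensity_selmerCorankTwoInfty_le_one_of W hS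
  have h0 : twistDensity (fun d ↦ ¬ (d ≠ 0 ∧ selmerCorankTwoInfty (W.quadraticTwist d) ≤ 1)) 0 := by
    simpa using hR.compl
  refine tendsto_familyProportion_one_of_twistDensity_zero (h0.mono_zero fun d _ h hRd ↦ h.2 ?_)
  obtain ⟨har, hrank, hsha⟩ :=
    bsdRank_quadraticTwist_of_selmerCorankTwoInfty_le_one hConv hR1 hGZK W hCM hgo h.1 hRd.2
  exact ⟨har.trans hrank.symm, hsha⟩

/-- **Goldfeld, odd half, with BSD, in `𝓕`** — from crux + residual + Modularity: among `d ∈ 𝓕`,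
`|d| ≤ X`, the proportion with `ord_{s=1} L(W^{(d)}, s) = rank W^{(d)}(ℚ) = 1` and `Ш(W^{(d)}/ℚ)`
finite tends to `1/2` (on the relative-density-`1` set of `tendsto_bsdRank_eq_selmerCorankTwoInfty`,
`r_an ≤ 1` and `w = −1 ↔ r_an = 1` by the functional equation; `w = −1` for half of `𝓕`).
[cite: arXiv250317619, Thm. 1.1 and Cor. 1.2] [cite: MurtyMurty1997, Ch. 6 §1] -/
theorem tendsto_familyProportion_rankOne
    (hConv : GoodOrdinaryRankZeroTwoConverse) (hR1 : RankOneTwoConverse)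
    (hGZK : rank_eq_analyticRank_of_analyticRank_le_one) (hmod : exists_isNewformOf)
    (hCM : ¬ W.HasCM) (hgo : GoodOrd W 2) (hS : smith_selmerCorank_density W) :
    Tendsto (fun X : ℕ ↦ (Nat.card {d : ℤ | Squarefree d ∧ |d| ≤ (X : ℤ) ∧ (d % 4 = 1 ∧
        ((W.quadraticTwist d).analyticRank = 1 ∧ (W.quadraticTwist d).mordellWeilRank = 1 ∧
          Finite (W.quadraticTwist d).sha))} : ℝ) /
      Nat.card {d : ℤ | Squarefree d ∧ |d| ≤ (X : ℤ) ∧ d % 4 = 1}) atTop (𝓝 (1 / 2)) := by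
  refine tendsto_familyProportion_of_congr_one
    (tendsto_familyProportion_rootNumber_eq_neg_one W hmod)
    (tendsto_bsdRank_eq_selmerCorankTwoInfty W hConv hR1 hGZK hCM hgo hS)
    fun d hd _ hR ↦ ?_
  obtain ⟨hle, hra, hrk, hsha⟩ := hR
  haveI := W.isElliptic_quadraticTwist (d := (d : ℚ)) (by exact_mod_cast hd.ne_zero)
  rw [rootNumber_eq_neg_one_iff_analyticRank_eq_one hmod _ (hra ▸ hle)]
  constructor
  · intro h1; exact ⟨h1, by rw [hrk, ← hra, h1], hsha⟩
  · exact fun h ↦ h.1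

/-- **Goldfeld, even half, via the functional equation** (variant of §2's
`tendsto_familyProportion_rankZero` with the residual available: Modularity's `(−1)^{r_an} = w`
replaces Monsky's `2`-parity). [cite: arXiv250317619, Thm. 1.1 and Cor. 1.2] [cite: MurtyMurty1997, Ch. 6 §1] -/
theorem tendsto_familyProportion_rankZero_of_residual
    (hConv : GoodOrdinaryRankZeroTwoConverse) (hR1 : RankOneTwoConverse)
    (hGZK : rank_eq_analyticRank_of_analyticRank_le_one) (hmod : exists_isNewformOf)
    (hCM : ¬ W.HasCM) (hgo : GoodOrd W 2) (hS : smith_selmerCorank_density W) :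
    Tendsto (fun X : ℕ ↦ (Nat.card {d : ℤ | Squarefree d ∧ |d| ≤ (X : ℤ) ∧ (d % 4 = 1 ∧
        ((W.quadraticTwist d).analyticRank = 0 ∧ (W.quadraticTwist d).mordellWeilRank = 0 ∧
          Finite (W.quadraticTwist d).sha))} : ℝ) /
      Nat.card {d : ℤ | Squarefree d ∧ |d| ≤ (X : ℤ) ∧ d % 4 = 1}) atTop (𝓝 (1 / 2)) := by
  refine tendsto_familyProportion_of_congr_one (tendsto_familyProportion_rootNumber_eq_one W hmod)
    (tendsto_bsdRank_eq_selmerCorankTwoInfty W hConv hR1 hGZK hCM hgo hS)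
    fun d hd _ hR ↦ ?_
  obtain ⟨hle, hra, hrk, hsha⟩ := hR
  haveI := W.isElliptic_quadraticTwist (d := (d : ℚ)) (by exact_mod_cast hd.ne_zero)
  rw [rootNumber_eq_one_iff_analyticRank_eq_zero hmod _ (hra ▸ hle)]
  constructor
  · intro h0; exact ⟨h0, by rw [hrk, ← hra, h0], hsha⟩
  · exact fun h ↦ h.1

end WithResidual

/-! ## §3 From the rung leaf S3 -/

section FromLeaf

variable (W : WeierstrassCurve ℚ) [W.IsElliptic] [W.IsGloballyMinimal]

/-- **THE RUNG'S HEAD LINE (LADDER-BSD §1 row S3) as a kernel theorem modulo named facts.** The leaf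
`NonCMTwoConverse` (the rank-`0`/`1` `2`-converse for non-CM curves good ordinary or multiplicative
at `2`), Gross–Zagier–Kolyvagin, Modularity and Smith's Thm. 1.1 for `W` give, for every globally
minimal NON-CM `W / ℚ` good ORDINARY at `2`: rank BSD (`ord_{s=1} L(W^{(d)}, s) = rank W^{(d)}(ℚ)`,
`Ш(W^{(d)}/ℚ)` finite) for `100 %` of the good twists `d ∈ 𝓕`, and Goldfeld's `50 / 50`
(rank `0` for half of `𝓕`, rank `1` for half of `𝓕`). [cite: arXiv250317619, Thm. 1.1 and Cor. 1.2]
[cite: MurtyMurty1997, Ch. 6 §1] -/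
theorem bsdRank_and_goldfeld_goodTwists_of_nonCMTwoConverse
    (hS3 : Summit.BirchSwinnertonDyer.BirchSwinnertonDyer.Rank1Residual.NonCMTwoConverse)
    (hGZK : rank_eq_analyticRank_of_analyticRank_le_one) (hmod : exists_isNewformOf)
    (hCM : ¬ W.HasCM) (hgo : GoodOrd W 2) (hS : smith_selmerCorank_density W) :
    Tendsto (fun X : ℕ ↦ (Nat.card {d : ℤ | Squarefree d ∧ |d| ≤ (X : ℤ) ∧ (d % 4 = 1 ∧
        ((W.quadraticTwist d).analyticRank = (W.quadraticTwist d).mordellWeilRank ∧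
          Finite (W.quadraticTwist d).sha))} : ℝ) /
      Nat.card {d : ℤ | Squarefree d ∧ |d| ≤ (X : ℤ) ∧ d % 4 = 1}) atTop (𝓝 1) ∧
    Tendsto (fun X : ℕ ↦ (Nat.card {d : ℤ | Squarefree d ∧ |d| ≤ (X : ℤ) ∧ (d % 4 = 1 ∧
        ((W.quadraticTwist d).analyticRank = 0 ∧ (W.quadraticTwist d).mordellWeilRank = 0 ∧
          Finite (W.quadraticTwist d).sha))} : ℝ) /
      Nat.card {d : ℤ | Squarefree d ∧ |d| ≤ (X : ℤ) ∧ d % 4 = 1}) atTop (𝓝 (1 / 2)) ∧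
    Tendsto (fun X : ℕ ↦ (Nat.card {d : ℤ | Squarefree d ∧ |d| ≤ (X : ℤ) ∧ (d % 4 = 1 ∧
        ((W.quadraticTwist d).analyticRank = 1 ∧ (W.quadraticTwist d).mordellWeilRank = 1 ∧
          Finite (W.quadraticTwist d).sha))} : ℝ) /
      Nat.card {d : ℤ | Squarefree d ∧ |d| ≤ (X : ℤ) ∧ d % 4 = 1}) atTop (𝓝 (1 / 2)) := by
  -- the leaf contains the rank-`0` crux (`r = 0`, good-ordinary branch) and the rank-`1`
  -- residual (`r = 1`), instantiated locally (no standalone declaration «leaf ⟹ item»)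
  have hConv : GoodOrdinaryRankZeroTwoConverse :=
    fun V _ _ hcm hgo' h0 ↦ hS3 V hcm (Or.inl hgo') 0 (Nat.zero_le 1) h0
  have hR1 : RankOneTwoConverse := fun V _ _ hcm hred h1 ↦ hS3 V hcm hred 1 le_rfl h1
  exact ⟨tendsto_bsdRank W hConv hR1 hGZK hCM hgo hS,
    tendsto_familyProportion_rankZero_of_residual W hConv hR1 hGZK hmod hCM hgo hS,
    tendsto_familyProportion_rankOne W hConv hR1 hGZK hmod hCM hgo hS⟩

end FromLeaf

end Summit.BirchSwinnertonDyer.BirchSwinnertonDyer.Theorems.TwoAdicGoodTwists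

end
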